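import Literature.MathematicalPhysics.KineticTheory.ChainControl
import Literature.MathematicalPhysics.KineticTheory.ConfinedControlReach
import Summits.AtomisticToContinuum.FouriersLaw.Theorems.BondHeatUncertaintySubdiffusiveBondHeatKernelGibbsA
import HarnessLib

/-!
# Crux `ExtensiveSnapshotIrreversibility` (stmt-AtomisticToContinuum-9121), line `clausius-budget-sound-window`:
sub-goal `ness_density_pos` (M0 of stub S1r) — helper file 1: irreducibility of the Langevin chain

Support lemmas toward the registered sub-goal `ness_density_pos` (strict positivity of the NESS density of
the pinned anharmonic chain). This file ports Rey-Bellet–Thomas 2002, Prop. 4.2 (irreducibility, proved in the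
tree for the auxiliary-field model, `ReyBelletThomas2002Control.lean`) to the Langevin chain
`dq = p dt`, `dp = (-∇Φ(q) - γ 1_B p) dt + √(2γT_b) dB` (`OscillatorChain.langevinKernel`, CEHR 2018 eq. (2.2)):

* `langevin_exists_control` — **controllability of the Langevin control system**: for a chain with confining
  potentials and `V'` onto, `γ, T_L, T_R > 0`, every `x₀, x_T`, `T > 0`, `ε > 0`, there are two Lipschitz
  controls `f₁, f₂` (vanishing at `0`) such that the trajectory driven by the noise path
  `f₁ v_L + f₂ v_R` is `ε`-close to `x_T` at time `T`. The frictionless chain with ONE force at site `0` is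
  approximately controllable (`OscillatorChain.chain_approxControl`, `ChainControl.lean`); the end frictions
  `-γ p_0`, `-γ p_{N-1}` along the steering trajectory are absorbed EXACTLY into the two bath controls, so
  the steering trajectory solves the Langevin integral equation with that noise path (no robustness step);
* `langevinKernel_pos_of_isOpen` — **irreducibility**: `P_t(x, U) > 0` for every `t > 0`, `x` and nonempty
  open `U` (support theorem, easy half: `ConfinedDrift.sdeKernel_pos_of_flow_mem`);
* `pinnedChain_surjective_deriv_V`, `pinnedChain_transitionKernel_pos_of_isOpen` (registered sub-goal) — the
  pinned chain `pinnedChain ω₂ lam β γ` (`ω₂, γ > 0`, `lam, β ≥ 0`): `V'(r) = r + βr³` is onto, and the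
  constructed transition kernels `transitionKernel` (= `langevinKernel`,
  `pinnedChain_langevinKernel_eq_transitionKernel`) charge every nonempty open set from every point at every
  positive time;
* `measure_pos_of_forall_kernel_pos`, `density_pos_of_lintegral_pos` — the two model-free measure-theoretic
  steps of Rey-Bellet–Thomas §5 on `PhaseSpace N`: an invariant probability measure of an irreducible kernel
  charges every open set; a continuous invariant density `g` satisfies `g(y₀) ≥ ∫ g(x) p(x, y₀) dx` (Tonelli,
  Fatou along a dense set of a.e.-equality, continuity), hence `g(y₀) > 0` whenever the right side is positive.

References: L. Rey-Bellet, L. E. Thomas, CMP 225 (2002) 305–329, Prop. 4.2, §5; N. Cuneo, J.-P. Eckmann,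
M. Hairer, L. Rey-Bellet, EJP 23 (2018) no. 55, Prop. 3.3; D. W. Stroock, S. R. S. Varadhan, Proc. Sixth
Berkeley Symp. III (1972) 333–359.
-/

noncomputable section

open MeasureTheory ProbabilityTheory Filter Topology Set Metric
open scoped NNReal ENNReal ContDiff

namespace Summit.AtomisticToContinuum.FouriersLaw.Theorems.ExtensiveSnapshotIrreversibility.ClausiusBudget

open Literature.MathematicalPhysics.KineticTheory.HeatConduction
open Literature.MathematicalPhysics.KineticTheory Literature.Probability.Process Literature.Analysis.ODE
  OscillatorChain
open Summit.AtomisticToContinuum.FouriersLaw.Theorems.SubdiffusiveBondHeat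

namespace LogDensity

variable {N : ℕ}

/-! ## 1. Controllability of the Langevin control system -/

/-- A primitive of a continuous function bounded by `B` on `[0, T]`, divided by `c > 0`, is
`L`-Lipschitz on `[0, T]` as soon as `B / c ≤ L`. [folklore] -/
theorem abs_primitive_div_sub_le {F : ℝ → ℝ} (hF : Continuous F) {c B L T : ℝ} (hc : 0 < c)
    (hFB : ∀ s ∈ Icc 0 T, ‖F s‖ ≤ B) (hBL : B / c ≤ L) :
    ∀ s u : ℝ, 0 ≤ s → s ≤ u → u ≤ T →
      |(∫ r in (0:ℝ)..u, F r) / c - (∫ r in (0:ℝ)..s, F r) / c| ≤ L * (u - s) := by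
  intro s u hs hsu huT
  rw [← sub_div, intervalIntegral.integral_interval_sub_left (hF.intervalIntegrable _ _)
    (hF.intervalIntegrable _ _), abs_div, abs_of_pos hc, div_le_iff₀ hc]
  have h1 : ‖∫ r in s..u, F r‖ ≤ B * |u - s| :=
    intervalIntegral.norm_integral_le_of_norm_le_const fun r hr => by
      rw [Set.uIoc_of_le hsu] at hr
      exact hFB r ⟨hs.trans hr.1.le, hr.2.trans huT⟩
  rw [Real.norm_eq_abs, abs_of_nonneg (sub_nonneg.2 hsu)] at h1
  have hus : 0 ≤ u - s := sub_nonneg.2 hsu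
  calc |∫ r in s..u, F r| ≤ B * (u - s) := h1
    _ = B / c * (u - s) * c := by field_simp
    _ ≤ L * (u - s) * c := mul_le_mul_of_nonneg_right (mul_le_mul_of_nonneg_right hBL hus) hc.le

/-- **Controllability of the Langevin control system** `q̇ = p`, `ṗ = -∇Φ(q) - γ 1_B p + v_L u_L + v_R u_R`
(Rey-Bellet–Thomas 2002, Prop. 4.2 / Eckmann–Pillet–Rey-Bellet 1999, Thm 3.2, for the Langevin baths): for a
chain with confining potentials and `V'` onto, `γ, T_L, T_R > 0`, `N = m + 1` sites, all `x₀, x_T`, `T > 0`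
and `ε > 0`, there are continuous controls `f₁, f₂` with `fᵢ(0) = 0`, Lipschitz on `[0, T]`, such that the
trajectory `drivenFlow` from `x₀` driven by the noise path `f₁ v_L + f₂ v_R` is `ε`-close to `x_T` at time `T`.
The steering force of `chain_approxControl` plus the left end friction is carried by `u_L`, the right end
friction by `u_R`. [cite: ReyBelletThomas2002, Prop 4.2] -/
theorem langevin_exists_control {P : OscillatorChain} (hP : P.IsConfining)
    (hVs : Function.Surjective (deriv P.V)) (hγ : 0 < P.γ) (m : ℕ) {T_L T_R : ℝ} (hTL : 0 < T_L)
    (hTR : 0 < T_R) {T : ℝ} (hT : 0 < T) (x₀ xT : PhaseSpace (m + 1)) {ε : ℝ} (hε : 0 < ε) :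
    ∃ (f₁ f₂ : ℝ → ℝ) (L : ℝ), Continuous f₁ ∧ Continuous f₂ ∧ f₁ 0 = 0 ∧ f₂ 0 = 0 ∧ 0 ≤ L ∧
      (∀ s u : ℝ, 0 ≤ s → s ≤ u → u ≤ T → |f₁ u - f₁ s| ≤ L * (u - s)) ∧
      (∀ s u : ℝ, 0 ≤ s → s ≤ u → u ≤ T → |f₂ u - f₂ s| ≤ L * (u - s)) ∧
      dist (drivenFlow (P.drift (m + 1)) x₀
        (controlPath (P.bathVecL (m + 1) T_L) (P.bathVecR (m + 1) T_R) f₁ f₂) T) xT ≤ ε := by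
  have hU2 : ContDiff ℝ 2 P.U := hP.contDiff_U
  have hV2 : ContDiff ℝ 2 P.V := hP.contDiff_V
  -- 1. the frictionless chain steered by one force at site `0`
  obtain ⟨φ, hφc, z, hzc, hz, hdist⟩ := chain_approxControl hU2 hV2 hVs m hT x₀ xT hε
  obtain ⟨hq, hp⟩ := (isIntegralSolutionOn_chain_iff hU2 hV2 hzc).1 hz
  have hp2c : ∀ i, Continuous fun s => (z s).2 i := fun i =>
    (continuous_apply i).comp (continuous_snd.comp hzc)
  -- 2. the bath amplitudes
  set cL : ℝ := Real.sqrt (2 * P.γ * T_L) with hcL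
  set cR : ℝ := Real.sqrt (2 * P.γ * T_R) with hcR
  have hcL0 : 0 < cL := Real.sqrt_pos.2 (by positivity)
  have hcR0 : 0 < cR := Real.sqrt_pos.2 (by positivity)
  have hvL2 : ∀ i : Fin (m + 1), (P.bathVecL (m + 1) T_L).2 i = if i.val = 0 then cL else 0 :=
    fun i => rfl
  have hvR2 : ∀ i : Fin (m + 1), (P.bathVecR (m + 1) T_R).2 i = if i.val = m + 1 - 1 then cR else 0 :=
    fun i => rfl
  have hvL1 : (P.bathVecL (m + 1) T_L).1 = 0 := rfl
  have hvR1 : (P.bathVecR (m + 1) T_R).1 = 0 := rfl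
  -- 3. the control forces: steering force plus left friction, and right friction
  set FL : ℝ → ℝ := fun s => φ s + P.γ * (z s).2 0 with hFL
  set FR : ℝ → ℝ := fun s => P.γ * (z s).2 (Fin.last m) with hFR
  have hFLc : Continuous FL := hφc.add (continuous_const.mul (hp2c 0))
  have hFRc : Continuous FR := continuous_const.mul (hp2c (Fin.last m))
  set f₁ : ℝ → ℝ := fun t => (∫ s in (0:ℝ)..t, FL s) / cL with hf₁
  set f₂ : ℝ → ℝ := fun t => (∫ s in (0:ℝ)..t, FR s) / cR with hf₂
  have hf₁c : Continuous f₁ :=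
    (intervalIntegral.continuous_primitive (fun _ _ => hFLc.intervalIntegrable _ _) 0).div_const _
  have hf₂c : Continuous f₂ :=
    (intervalIntegral.continuous_primitive (fun _ _ => hFRc.intervalIntegrable _ _) 0).div_const _
  have hf₁0 : f₁ 0 = 0 := by simp [hf₁]
  have hf₂0 : f₂ 0 = 0 := by simp [hf₂]
  -- 4. Lipschitz bounds on `[0, T]`
  obtain ⟨BL, hBL⟩ := isCompact_Icc.exists_bound_of_continuousOn (hFLc.continuousOn (s := Icc 0 T))
  obtain ⟨BR, hBR⟩ := isCompact_Icc.exists_bound_of_continuousOn (hFRc.continuousOn (s := Icc 0 T))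
  have hBL0 : 0 ≤ BL := (norm_nonneg _).trans (hBL 0 ⟨le_rfl, hT.le⟩)
  have hBR0 : 0 ≤ BR := (norm_nonneg _).trans (hBR 0 ⟨le_rfl, hT.le⟩)
  set L : ℝ := BL / cL + BR / cR with hL
  have hL0 : 0 ≤ L := by positivity
  have hLip₁ : ∀ s u : ℝ, 0 ≤ s → s ≤ u → u ≤ T → |f₁ u - f₁ s| ≤ L * (u - s) :=
    abs_primitive_div_sub_le hFLc hcL0 hBL (by rw [hL]; exact le_add_of_nonneg_right (by positivity))
  have hLip₂ : ∀ s u : ℝ, 0 ≤ s → s ≤ u → u ≤ T → |f₂ u - f₂ s| ≤ L * (u - s) :=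
    abs_primitive_div_sub_le hFRc hcR0 hBR (by rw [hL]; exact le_add_of_nonneg_left (by positivity))
  -- 5. the noise path and its components
  set n : ℝ → PhaseSpace (m + 1) :=
    controlPath (P.bathVecL (m + 1) T_L) (P.bathVecR (m + 1) T_R) f₁ f₂ with hn
  have hnc : Continuous n := continuous_controlPath _ _ hf₁c hf₂c
  have hnS : ∀ t, n t ∈ (hP.confinedDrift (m + 1)).noise := fun t =>
    controlPath_mem (hP.bathVecL_mem_noise (m + 1) T_L) (hP.bathVecR_mem_noise (m + 1) T_R) f₁ f₂ t
  have hn1 : ∀ t i, (n t).1 i = 0 := fun t i => by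
    show (f₁ t • P.bathVecL (m + 1) T_L + f₂ t • P.bathVecR (m + 1) T_R).1 i = 0
    rw [Prod.fst_add, Prod.smul_fst, Prod.smul_fst, hvL1, hvR1, smul_zero, smul_zero, add_zero,
      Pi.zero_apply]
  have hn2 : ∀ t i, (n t).2 i = (if i.val = 0 then ∫ s in (0:ℝ)..t, FL s else 0) +
      (if i.val = m + 1 - 1 then ∫ s in (0:ℝ)..t, FR s else 0) := fun t i => by
    show (f₁ t • P.bathVecL (m + 1) T_L + f₂ t • P.bathVecR (m + 1) T_R).2 i = _
    rw [Prod.snd_add, Pi.add_apply, Prod.smul_snd, Prod.smul_snd, Pi.smul_apply, Pi.smul_apply,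
      smul_eq_mul, smul_eq_mul, hvL2, hvR2]
    congr 1
    · split_ifs
      · rw [hf₁, div_mul_cancel₀ _ hcL0.ne']
      · rw [mul_zero]
    · split_ifs
      · rw [hf₂, div_mul_cancel₀ _ hcR0.ne']
      · rw [mul_zero]
  have hIL : ∀ t, ∫ s in (0:ℝ)..t, FL s = (∫ s in (0:ℝ)..t, φ s) + P.γ * ∫ s in (0:ℝ)..t, (z s).2 0 :=
    fun t => by
    simp only [hFL]
    rw [intervalIntegral.integral_add (hφc.intervalIntegrable _ _)
      (((hp2c 0).const_mul _).intervalIntegrable _ _), intervalIntegral.integral_const_mul]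
  have hIR : ∀ t, ∫ s in (0:ℝ)..t, FR s = P.γ * ∫ s in (0:ℝ)..t, (z s).2 (Fin.last m) := fun t => by
    simp only [hFR]
    rw [intervalIntegral.integral_const_mul]
  -- the momentum components of the noise path: steering force plus the absorbed frictions
  have key : ∀ (t : ℝ) (i : Fin (m + 1)), (n t).2 i =
      (∫ s in (0:ℝ)..t, φ s) * (if i.val = 0 then 1 else 0) +
        P.γ * bathWeight (m + 1) i * ∫ s in (0:ℝ)..t, (z s).2 i := by
    intro t i
    rw [hn2 t i, hIL t, hIR t]
    simp only [bathWeight]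
    by_cases h0 : i.val = 0
    · have e0 : (0 : Fin (m + 1)) = i := Fin.ext (by rw [h0]; rfl)
      rw [if_pos h0, if_pos h0, e0]
      by_cases hm : i.val = m + 1 - 1
      · have em : Fin.last m = i := Fin.ext (by rw [Fin.val_last, hm, Nat.add_sub_cancel])
        rw [if_pos hm, if_pos hm, em]; ring
      · rw [if_neg hm, if_neg hm]; ring
    · rw [if_neg h0, if_neg h0]
      by_cases hm : i.val = m + 1 - 1
      · have em : Fin.last m = i := Fin.ext (by rw [Fin.val_last, hm, Nat.add_sub_cancel])
        rw [if_pos hm, if_pos hm, em]; ring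
      · rw [if_neg hm, if_neg hm]; ring
  -- 6. the steering trajectory solves the Langevin integral equation with the noise path `n`
  have hY : ∀ y, P.drift (m + 1) y =
      (y.2, fun i => -P.dPotential (m + 1) i y.1 - P.γ * bathWeight (m + 1) i * y.2 i) := fun y => by
    rw [P.drift_eq hP.differentiable_U hP.differentiable_V]
  have hYc : Continuous fun s => P.drift (m + 1) (z s) :=
    (P.contDiff_one_drift hU2 hV2 (m + 1)).continuous.comp hzc
  have hsol : IsIntegralSolutionOn (P.drift (m + 1)) (fun t => x₀ + n t) z T := by
    intro t ht
    obtain ⟨e1, e2⟩ := integral_phaseSpace_apply hYc 0 t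
    refine Prod.ext (funext fun i => ?_) (funext fun i => ?_)
    · -- positions
      show (z t).1 i = (x₀ + n t).1 i + (∫ s in (0:ℝ)..t, P.drift (m + 1) (z s)).1 i
      rw [e1, Prod.fst_add, Pi.add_apply, hn1, add_zero]
      have hc : (fun s => (P.drift (m + 1) (z s)).1 i) = fun s => (z s).2 i :=
        funext fun s => by rw [hY]
      simp only [hc]
      rw [hq t ht i, chainForcing_fst]
    · -- momenta
      show (z t).2 i = (x₀ + n t).2 i + (∫ s in (0:ℝ)..t, P.drift (m + 1) (z s)).2 i
      rw [e2, Prod.snd_add, Pi.add_apply, key t i]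
      have hc : (fun s => (P.drift (m + 1) (z s)).2 i) =
          fun s => -P.dPotential (m + 1) i (z s).1 - P.γ * bathWeight (m + 1) i * (z s).2 i :=
        funext fun s => by rw [hY]
      simp only [hc]
      have hc1 : Continuous fun s => -P.dPotential (m + 1) i (z s).1 :=
        ((continuous_dPotential hU2 hV2 (m + 1) i).comp (continuous_fst.comp hzc)).neg
      have hc2 : Continuous fun s => P.γ * bathWeight (m + 1) i * (z s).2 i :=
        continuous_const.mul (hp2c i)
      rw [intervalIntegral.integral_sub (hc1.intervalIntegrable _ _) (hc2.intervalIntegrable _ _),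
        intervalIntegral.integral_neg, intervalIntegral.integral_const_mul, hp t ht i]
      have hcf : (chainForcing m x₀ φ t).2 i =
          x₀.2 i + (∫ s in (0:ℝ)..t, φ s) * (if i.val = 0 then 1 else 0) := by
        simp only [chainForcing, Prod.snd_add, Pi.add_apply, Prod.smul_snd, Pi.smul_apply, smul_eq_mul,
          forceDir, Pi.single_apply, Fin.ext_iff, Fin.val_zero]
      rw [hcf]
      ring
  -- 7. hence the steering trajectory is the driven flow
  have hflow : EqOn z (drivenFlow (P.drift (m + 1)) x₀ n) (Icc 0 T) :=
    (hP.confinedDrift (m + 1)).toConfinedDrift.eqOn_flow x₀ hnc hnS hsol hzc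
  refine ⟨f₁, f₂, L, hf₁c, hf₂c, hf₁0, hf₂0, hL0, hLip₁, hLip₂, ?_⟩
  rw [← hflow ⟨hT.le, le_rfl⟩]
  exact hdist

/-! ## 2. Irreducibility of the Langevin chain -/

/-- **Irreducibility of the Langevin chain at every positive time** (Rey-Bellet–Thomas 2002, Prop. 4.2;
CEHR 2018, Prop. 3.3, full form): for a chain with confining potentials and `V'` onto, `γ, T_L, T_R > 0`,
`N ≥ 1`: `P_t(x, U) > 0` for every `t > 0`, every `x` and every nonempty open `U` — the controlled
trajectory of `langevin_exists_control` ends in `U`, and the support theorem (easy half,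
`ConfinedDrift.sdeKernel_pos_of_flow_mem`) applies. [cite: ReyBelletThomas2002, Prop 4.2] -/
theorem langevinKernel_pos_of_isOpen {P : OscillatorChain} (hP : P.IsConfining)
    (hVs : Function.Surjective (deriv P.V)) (hγ : 0 < P.γ) (hN : 0 < N) {T_L T_R : ℝ} (hTL : 0 < T_L)
    (hTR : 0 < T_R) (x : PhaseSpace N) {U : Set (PhaseSpace N)} (hUo : IsOpen U) (hne : U.Nonempty)
    {t : ℝ≥0} (ht : 0 < t) : 0 < P.langevinKernel N T_L T_R t x U := by
  obtain ⟨m, rfl⟩ : ∃ m, N = m + 1 := ⟨N - 1, by omega⟩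
  obtain ⟨xT, hxT⟩ := hne
  obtain ⟨r, hr, hrU⟩ := Metric.isOpen_iff.1 hUo xT hxT
  have ht' : 0 < (t : ℝ) := ht
  obtain ⟨f₁, f₂, L, hf₁c, hf₂c, hf₁0, hf₂0, hL, hLip₁, hLip₂, hdist⟩ :=
    langevin_exists_control hP hVs hγ m hTL hTR ht' x xT (half_pos hr)
  have hmem : drivenFlow (P.drift (m + 1)) x
      (controlPath (P.bathVecL (m + 1) T_L) (P.bathVecR (m + 1) T_R) f₁ f₂) t ∈ U :=
    hrU (mem_ball.2 (lt_of_le_of_lt hdist (half_lt_self hr)))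
  exact (hP.confinedDrift (m + 1)).toConfinedDrift.sdeKernel_pos_of_flow_mem
    (hP.bathVecL_mem_noise (m + 1) T_L) (hP.bathVecR_mem_noise (m + 1) T_R) x hf₁c hf₂c hf₁0 hf₂0 hL
    hLip₁ hLip₂ hUo hmem

/-! ## 3. The pinned chain -/

/-- For the pinned anharmonic chain (`V(r) = r²/2 + βr⁴/4`, `β ≥ 0`) the bond force `V'(r) = r + βr³` is
onto. [folklore] -/
theorem pinnedChain_surjective_deriv_V (ω₂ lam γ : ℝ) {β : ℝ} (hβ : 0 ≤ β) :
    Function.Surjective (deriv (pinnedChain ω₂ lam β γ).V) := by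
  have hV : deriv (pinnedChain ω₂ lam β γ).V = fun r => r + β * r ^ 3 := by
    funext r
    have h : HasDerivAt (fun r : ℝ => r ^ 2 / 2 + β * r ^ 4 / 4)
        ((2 : ℕ) * r ^ (2 - 1) / 2 + β * ((4 : ℕ) * r ^ (4 - 1)) / 4) r :=
      ((hasDerivAt_pow 2 r).div_const 2).add (((hasDerivAt_pow 4 r).const_mul β).div_const 4)
    rw [show (pinnedChain ω₂ lam β γ).V = fun r : ℝ => r ^ 2 / 2 + β * r ^ 4 / 4 from rfl, h.deriv]
    push_cast
    ring
  rw [hV]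
  have hc : Continuous fun r : ℝ => r + β * r ^ 3 := by fun_prop
  have htop : Tendsto (fun r : ℝ => r + β * r ^ 3) atTop atTop :=
    tendsto_id.atTop_add_zero_eventuallyLE
      ((eventually_ge_atTop 0).mono fun r hr => show (0 : ℝ) ≤ β * r ^ 3 by positivity)
  have hbot : Tendsto (fun r : ℝ => r + β * r ^ 3) atBot atBot :=
    tendsto_id.atBot_add_eventuallyLE_zero
      ((eventually_le_atBot 0).mono fun r hr => show β * r ^ 3 ≤ (0 : ℝ) from
        mul_nonpos_of_nonneg_of_nonpos hβ (Odd.pow_nonpos (by decide : Odd 3) hr))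
  exact hc.surjective htop hbot

/-- **Irreducibility of the pinned anharmonic chain** (registered sub-goal of `ness_density_pos`): for
`pinnedChain ω₂ lam β γ` with `ω₂, γ > 0`, `lam, β ≥ 0`, `N ≥ 1`, `T_L, T_R > 0`, the constructed transition
kernels charge every nonempty open set from every point at every positive time, `P_t(x, U) > 0`.
[cite: CuneoEckmannHairerReyBellet2018, Prop 3.3] [cite: ReyBelletThomas2002, Prop 4.2] -/
theorem pinnedChain_transitionKernel_pos_of_isOpen :
    ∀ ω₂ lam β γ : ℝ, 0 < ω₂ → 0 ≤ lam → 0 ≤ β → 0 < γ → ∀ (N : ℕ), 0 < N →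
      ∀ T_L T_R : ℝ, 0 < T_L → 0 < T_R → ∀ t : ℝ≥0, 0 < t →
        ∀ (x : PhaseSpace N) (U : Set (PhaseSpace N)), IsOpen U → U.Nonempty →
          0 < (pinnedChain ω₂ lam β γ).transitionKernel N T_L T_R t x U := by
  intro ω₂ lam β γ hω hl hβ hγ N hN T_L T_R hTL hTR t ht x U hUo hne
  rw [← pinnedChain_langevinKernel_eq_transitionKernel N T_L T_R hω hl hβ hγ.le t]
  exact langevinKernel_pos_of_isOpen (pinnedChain_isConfining hω hl hβ hγ.le)
    (pinnedChain_surjective_deriv_V ω₂ lam γ hβ) hγ hN hTL hTR x hUo hne ht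

/-! ## 4. Two model-free steps of the positivity argument -/

/-- **An invariant probability measure of a kernel charging `U` from every point charges `U`**:
`μ(U) = ∫ P(z, U) μ(dz) > 0`. [cite: ReyBelletThomas2002, §5] -/
theorem measure_pos_of_forall_kernel_pos {κ : Kernel (PhaseSpace N) (PhaseSpace N)}
    {μ : Measure (PhaseSpace N)} [IsProbabilityMeasure μ] (hinv : μ.bind κ = μ)
    {U : Set (PhaseSpace N)} (hU : MeasurableSet U) (hpos : ∀ z, 0 < κ z U) : 0 < μ U := by
  rw [← hinv, Measure.bind_apply hU (Kernel.measurable κ).aemeasurable]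
  refine pos_iff_ne_zero.2 fun h0 => ?_
  have hae := (lintegral_eq_zero_iff (Kernel.measurable_coe κ hU)).1 h0
  have hfalse : ∀ᵐ z ∂μ, False := hae.mono fun z hz => (hpos z).ne' hz
  rw [eventually_false_iff_eq_bot, ae_eq_bot] at hfalse
  exact IsProbabilityMeasure.ne_zero μ hfalse

/-- **A continuous invariant density is positive wherever `∫ p(x, y₀) μ(dx) > 0`.** For a kernel `κ`
with jointly continuous Lebesgue densities `p(x, ·)`, an invariant probability measure `μ = g · Leb`
(`μ κ = μ`) with `g` continuous, and a point `y₀` with `∫ p(x, y₀) μ(dx) > 0`: `g(y₀) > 0`. Indeed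
`g = ∫ g(x) p(x, ·) dx` a.e. (invariance, Tonelli), the right side is lower semicontinuous (Fatou),
and `g` is continuous, so `g(y₀) ≥ ∫ g(x) p(x, y₀) dx` along a sequence from the dense set of equality.
[cite: ReyBelletThomas2002, Thm 2.1] -/
theorem density_pos_of_lintegral_pos {κ : Kernel (PhaseSpace N) (PhaseSpace N)}
    {μ : Measure (PhaseSpace N)} [IsProbabilityMeasure μ] (hinv : μ.bind κ = μ)
    {g : PhaseSpace N → ℝ} (hg : Continuous g)
    (hμ : μ = (volume : Measure (PhaseSpace N)).withDensity fun x => ENNReal.ofReal (g x))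
    {p : PhaseSpace N → PhaseSpace N → ℝ}
    (hpc : Continuous fun q : PhaseSpace N × PhaseSpace N => p q.1 q.2)
    (hpt : ∀ x, κ x = (volume : Measure (PhaseSpace N)).withDensity fun y => ENNReal.ofReal (p x y))
    (y₀ : PhaseSpace N) (hGpos : 0 < ∫⁻ x, ENNReal.ofReal (p x y₀) ∂μ) : 0 < g y₀ := by
  haveI := isAddHaarMeasure_volume_phaseSpace N
  set F : PhaseSpace N × PhaseSpace N → ℝ≥0∞ := fun q => ENNReal.ofReal (p q.1 q.2) with hF
  have hFm : Measurable F := ENNReal.measurable_ofReal.comp hpc.measurable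
  set G : PhaseSpace N → ℝ≥0∞ := fun y => ∫⁻ x, F (x, y) ∂μ with hGdef
  have hGm : Measurable G := hFm.lintegral_prod_left'
  have hgm : Measurable fun y => ENNReal.ofReal (g y) := ENNReal.measurable_ofReal.comp hg.measurable
  have hinvA : ∀ A : Set (PhaseSpace N), MeasurableSet A → ∫⁻ x, κ x A ∂μ = μ A := fun A hA => by
    conv_rhs => rw [← hinv]
    rw [Measure.bind_apply hA (Kernel.measurable κ).aemeasurable]
  have heq : (volume : Measure (PhaseSpace N)).withDensity (fun y => ENNReal.ofReal (g y)) =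
      (volume : Measure (PhaseSpace N)).withDensity G := by
    refine Measure.ext fun A hA => ?_
    rw [← hμ, ← hinvA A hA, withDensity_apply _ hA]
    have h1 : ∀ x, κ x A = ∫⁻ y in A, F (x, y) ∂volume := fun x => by
      rw [hpt x, withDensity_apply _ hA]
    simp_rw [h1]
    rw [lintegral_lintegral_swap (f := fun x y => F (x, y))
      (hFm.comp (measurable_fst.prodMk measurable_snd)).aemeasurable]
  have hae : (fun y => ENNReal.ofReal (g y)) =ᵐ[(volume : Measure (PhaseSpace N))] G :=
    (withDensity_eq_iff_of_sigmaFinite hgm.aemeasurable hGm.aemeasurable).1 heq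
  have hdense : Dense {y : PhaseSpace N | ENNReal.ofReal (g y) = G y} := Measure.dense_of_ae hae
  obtain ⟨u, hu, hut⟩ := mem_closure_iff_seq_limit.1 (hdense.closure_eq.symm ▸ mem_univ y₀ :
    y₀ ∈ closure {y : PhaseSpace N | ENNReal.ofReal (g y) = G y})
  have hGle : G y₀ ≤ ENNReal.ofReal (g y₀) := by
    have hlim : ∀ x, Tendsto (fun k => F (x, u k)) atTop (𝓝 (F (x, y₀))) := fun x =>
      ((ENNReal.continuous_ofReal.comp hpc).tendsto (x, y₀)).comp
        (tendsto_const_nhds.prodMk_nhds hut)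
    calc G y₀ = ∫⁻ x, liminf (fun k => F (x, u k)) atTop ∂μ :=
          lintegral_congr fun x => ((hlim x).liminf_eq).symm
      _ ≤ liminf (fun k => ∫⁻ x, F (x, u k) ∂μ) atTop :=
          lintegral_liminf_le fun k => hFm.comp (measurable_id.prodMk measurable_const)
      _ = liminf (fun k => ENNReal.ofReal (g (u k))) atTop :=
          liminf_congr (Eventually.of_forall fun k => (hu k).symm)
      _ = ENNReal.ofReal (g y₀) :=
          (((ENNReal.continuous_ofReal.comp hg).tendsto y₀).comp hut).liminf_eq
  have hGpos' : 0 < G y₀ := hGpos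
  exact ENNReal.ofReal_pos.1 (hGpos'.trans_le hGle)

end LogDensity

end Summit.AtomisticToContinuum.FouriersLaw.Theorems.ExtensiveSnapshotIrreversibility.ClausiusBudget

end
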